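import Literature.AnabelianGeometry.SemiGraphs.CoverticialRemark241OfComp
import Literature.AnabelianGeometry.SemiGraphs.FiniteEtaleCoveringOfIso
import Literature.AnabelianGeometry.SemiGraphs.FiniteEtaleCoveringCompGlobal
import Literature.AnabelianGeometry.SemiGraphs.BranchAlignedComp
import Literature.AnabelianGeometry.SemiGraphs.FiniteEtaleCoveringCompVertexAligned
import Literature.AnabelianGeometry.SemiGraphs.FiniteEtaleCoveringGlobalHolds
import HarnessLib

/-!
# [SemiAnbd] Rmk. 2.4.1 along finite étale coverings (FACT-LIST F-1478): the assembly over ALIGNED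
# LOCAL DATA, the UNCONDITIONAL instance at print's constructed covering `𝒢_A → 𝒢`, and the
# reduction of the abstract fact to covering rigidity (J1)

Mochizuki, *Semi-graphs of anabelioids*, Publ. RIMS **42** (2006) 221–322, §2: Rmk. 2.4.1 p. 26
(second sentence: along a finite étale covering, vertices over elevated vertices are elevated and edges
over universally sub-coverticial / aloof / estranged edges are universally sub-coverticial / aloof /
estranged), Def. 2.2 (i) p. 23 (the covering `𝒢′ → 𝒢` attached to `G′ ∈ Ob(B(𝒢))`: "`B′ = B(𝒢)_{G′}` …
arises naturally as the `B(−)` of … `𝒢′`"), Rmk. 2.4.2 p. 26 (composition).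
[cite: MochizukiSemiAnbd2006, Rem. 2.4.1 p.26]

PROOF-ONLY companion (abc-iut cell, block F, row F-1478 `remark_2_4_1_covering`, assembly seat
abc-iut-f-161; no definition, no new `Prop`).  The universally-sub-coverticial clause c2 of Rmk. 2.4.1
is, in the kernel, exactly «print's finite étale coverings compose» (abc-iut-f-161,
`remark_2_4_1_covering_of_comp_isFiniteEtaleCoveringGlobal`); of the four clauses of the cell's
covering notion `Hom.IsFiniteEtaleCoveringGlobal` = «local ∧ global ∧ branch-aligned ∧ vertex-aligned»
three compose for arbitrary factors (GLOBAL: `Hom.IsGlobalCoveringOf.comp_explicit`, abc-iut-f-161;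
BRANCH: `Hom.IsBranchAligned.comp`, abc-iut-w5-d177; VERTEX: `Hom.IsVertexAligned.comp`,
abc-iut-f-160) and the LOCAL clause composes as soon as the SECOND factor carries ALIGNED LOCAL DATA
whose lift is an equivalence compatible with its pull-back functor (abc-iut-L3-t1,
`Hom.IsFiniteEtaleCoveringOf.comp_of_alignedLocalData` + `congr_iso`).  This file assembles:

* `Hom.isFiniteEtaleCoveringGlobal_comp_of_alignedLocalData` — composites `𝒢″ → 𝒢′ → 𝒢` of print's
  coverings are print's coverings whenever the base factor `𝒢′ → 𝒢` carries aligned local data lifting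
  to its global equivalence;
* `Hom.IsFiniteEtaleCoveringGlobal.comp_coveringHomCan` — **UNCONDITIONALLY** for the base factor
  `𝒢_A → 𝒢` = print's CONSTRUCTED covering (`BObj.coveringHomCan`; its aligned data
  `BObj.alignedLocalDataCan`, abc-iut-L3-t1 (J0)): every finite étale covering of `𝒢_A` in print's sense
  composes with `𝒢_A → 𝒢` to a finite étale covering of `𝒢` in print's sense (p. 23: a finite étale
  covering of `B(𝒢)_{G′}` "may also be regarded as a finite étale covering of `B(𝒢)`");
* `BObj.coveringHomCan_isUniversallySubCoverticial`, `BObj.remark_2_4_1_coveringHomCan` — hence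
  **Rmk. 2.4.1 (all four clauses) holds UNCONDITIONALLY along print's constructed covering `𝒢_A → 𝒢`**,
  for every semi-graph of anabelioids `𝒢` and every object `A` of `B(𝒢)` — the INSTANCE FORM of
  F-1478 at the covering of record (the class of coverings print DEFINES, Def. 2.2 (i) p. 23 l. 22–27:
  "an arrow `𝒢′ → 𝒢` that arises as in the above discussion");
* `Hom.isFiniteEtaleCoveringGlobal_comp_of_rigidity`, `remark_2_4_1_covering_of_rigidity` — the named
  fact F-1478 for the cell's ABSTRACT four-clause coverings, CONDITIONAL EXACTLY on the rigidity
  junction (J1) «every covering in print's four-clause sense admits aligned local data lifting to its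
  global equivalence» (= comparison of an abstract covering with `𝒢_A`; Bass, *Covering theory for
  graphs of groups*, JPAA 89 (1993), profinite form), stated VERBATIM as a hypothesis binder (no `Prop`
  is introduced; typed ≠ proved).

Nothing here takes a side on [IUTchIII] Cor. 3.12.
-/

namespace Literature.AnabelianGeometry.SemiGraphs

open CategoryTheory CategoryTheory.Limits

universe v₁ u₁ u

namespace SemiGraphOfAnabelioids

variable {𝒢 𝒢' 𝒢'' : SemiGraphOfAnabelioids.{v₁, u₁, u}}

/-! ### The assembly over aligned local data of the base factor -/

/-- **Composites over a base covering with aligned local data are print's coverings** ([SemiAnbd]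
Rmk. 2.4.2 / Def. 2.2 (i)).  Let `φ : 𝒢′ → 𝒢` lie over a proper morphism, be branch- and vertex-aligned,
and carry aligned local data `𝔇` over `A ∈ B(𝒢)` whose lift `B(𝒢)_{/A} ⥤ B(𝒢′)` is an equivalence with
`φ^* ≅ (A × −) ⋙ 𝔇.lift`.  Then for every finite étale covering `ψ : 𝒢″ → 𝒢′` in print's sense the
composite `ψ.comp φ : 𝒢″ → 𝒢` is a finite étale covering of `𝒢` in print's sense — over the object
`(𝔇.lift⁻¹ B).left` of `B(𝒢)`, `B ∈ B(𝒢′)` the object of `ψ`: LOCAL by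
`Hom.IsFiniteEtaleCoveringOf.comp_of_alignedLocalData` (after `congr_iso` along `B ≅ 𝔇.lift (𝔇.lift⁻¹ B)`),
GLOBAL by `Hom.IsGlobalCoveringOf.comp_explicit` with `α := 𝔇.lift`, BRANCH by `Hom.IsBranchAligned.comp`,
VERTEX by `Hom.IsVertexAligned.comp`. [cite: MochizukiSemiAnbd2006, Rem. 2.4.2 p.26] -/
theorem Hom.isFiniteEtaleCoveringGlobal_comp_of_alignedLocalData {ψ : Hom 𝒢'' 𝒢'} {φ : Hom 𝒢' 𝒢}
    {A : 𝒢.BObj} [HasBinaryProducts 𝒢.BObj] (𝔇 : φ.AlignedLocalData A) [𝔇.lift.IsEquivalence]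
    (e : φ.pullbackFunctor ≅ Over.star A ⋙ 𝔇.lift) (hφp : SemiGraph.IsProper φ.base)
    (hφb : φ.IsBranchAligned) (hφv : φ.IsVertexAligned) (hψ : ψ.IsFiniteEtaleCoveringGlobal) :
    (ψ.comp φ).IsFiniteEtaleCoveringGlobal := by
  have hφg : φ.IsGlobalCoveringOf A := ⟨inferInstance, 𝔇.lift, inferInstance, ⟨e⟩⟩
  obtain ⟨B, hψl, hψg, hψb, hψv⟩ := hψ
  exact ⟨(𝔇.lift.inv.obj B).left,
    Hom.IsFiniteEtaleCoveringOf.comp_of_alignedLocalData 𝔇 (𝔇.lift.inv.obj B) hφp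
      (hψl.congr_iso (𝔇.lift.asEquivalence.counitIso.app B).symm),
    Hom.IsGlobalCoveringOf.comp_explicit hψg 𝔇.lift e, hψb.comp hφb, hψv.comp hφv ⟨A, hφg⟩⟩

/-- **Rmk. 2.4.1 c2 for a base covering with aligned local data**: along such a `φ : 𝒢′ → 𝒢` (also
locally attached to `A`), an edge over a universally sub-coverticial edge of `𝒢` is universally
sub-coverticial — composition with `φ` preserves print's coverings (`isUniversallySubCoverticial_of_comp`,
abc-iut-f-161). [cite: MochizukiSemiAnbd2006, Rem. 2.4.1 p.26] -/
theorem Hom.isUniversallySubCoverticial_of_alignedLocalData {φ : Hom 𝒢' 𝒢} {A : 𝒢.BObj}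
    [HasBinaryProducts 𝒢.BObj] (𝔇 : φ.AlignedLocalData A) [𝔇.lift.IsEquivalence]
    (e : φ.pullbackFunctor ≅ Over.star A ⋙ 𝔇.lift) (hφl : φ.IsFiniteEtaleCoveringOf A)
    (hφb : φ.IsBranchAligned) (hφv : φ.IsVertexAligned)
    (e' : 𝒢'.graph.Edge) (h : 𝒢.IsUniversallySubCoverticial (φ.base.edgeMap e')) :
    𝒢'.IsUniversallySubCoverticial e' :=
  isUniversallySubCoverticial_of_comp
    ⟨A, hφl, ⟨inferInstance, 𝔇.lift, inferInstance, ⟨e⟩⟩, hφb, hφv⟩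
    (fun _ _ hψ => Hom.isFiniteEtaleCoveringGlobal_comp_of_alignedLocalData 𝔇 e hφl.isProper hφb hφv hψ)
    e' h

/-! ### The unconditional instance: print's constructed covering `𝒢_A → 𝒢` -/

/-- **Finite étale coverings of `𝒢_A` compose with `𝒢_A → 𝒢` to finite étale coverings of `𝒢`,
unconditionally** ([SemiAnbd] p. 23: a finite étale covering of `B′ = B(𝒢)_{G′}` "may also be regarded
as a finite étale covering of `B(𝒢)`"; Rmk. 2.4.2): for every object `A` of `B(𝒢)` and every finite étale
covering `ψ : 𝒢″ → 𝒢_A` in print's (four-clause) sense, `ψ.comp (coveringHomCan A) : 𝒢″ → 𝒢` is a finite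
étale covering in print's sense — the assembly `isFiniteEtaleCoveringGlobal_comp_of_alignedLocalData` at
print's aligned data `BObj.alignedLocalDataCan` (abc-iut-L3-t1 (J0): lift ≅ `toCovering`, an
equivalence, with `(coveringHomCan A)^* ≅ (A × −) ⋙ lift`), properness of the projection `𝔾_A → 𝔾`,
and branch / vertex alignment of `𝒢_A → 𝒢` (abc-iut-L4-t17 / abc-iut-L6-d4, abc-iut-L3-t5).
[cite: MochizukiSemiAnbd2006, Rem. 2.4.2 p.26] -/
theorem Hom.IsFiniteEtaleCoveringGlobal.comp_coveringHomCan (A : 𝒢.BObj) {ψ : Hom 𝒢'' A.coveringGraph}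
    (hψ : ψ.IsFiniteEtaleCoveringGlobal) : (ψ.comp A.coveringHomCan).IsFiniteEtaleCoveringGlobal := by
  haveI := hasBinaryProducts_bObj 𝒢
  haveI := A.alignedLocalDataCan_lift_isEquivalence
  exact Hom.isFiniteEtaleCoveringGlobal_comp_of_alignedLocalData A.alignedLocalDataCan
    A.coveringHomCan_pullbackFunctor_iso_star_lift A.fibreData.isProper_proj
    A.coveringHomCan_isBranchAligned A.coveringHomCan_isVertexAligned hψ

/-- **Rmk. 2.4.1 c2 along print's constructed covering, unconditionally**: for every object `A` of
`B(𝒢)`, an edge of `𝒢_A` lying over a universally sub-coverticial edge of `𝒢` is universally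
sub-coverticial in `𝒢_A`. [cite: MochizukiSemiAnbd2006, Rem. 2.4.1 p.26] -/
theorem BObj.coveringHomCan_isUniversallySubCoverticial (A : 𝒢.BObj) (e' : A.coveringGraph.graph.Edge)
    (h : 𝒢.IsUniversallySubCoverticial (A.coveringHomCan.base.edgeMap e')) :
    A.coveringGraph.IsUniversallySubCoverticial e' :=
  isUniversallySubCoverticial_of_comp A.coveringHomCan_isFiniteEtaleCoveringGlobal
    (fun _ _ hψ => hψ.comp_coveringHomCan A) e' h

/-- **[SemiAnbd] Remark 2.4.1 along print's constructed covering `𝒢_A → 𝒢` — all four clauses,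
UNCONDITIONALLY** (the instance form of FACT-LIST row F-1478 `remark_2_4_1_covering` at the covering of
record, Def. 2.2 (i) p. 23: the finite étale coverings of `𝒢` ARE, by print's definition, the arrows
arising from this construction): for every semi-graph of anabelioids `𝒢` and every object `A` of
`B(𝒢)`, a vertex of `𝒢_A` over an elevated vertex is elevated, and an edge of `𝒢_A` over a universally
sub-coverticial (resp. aloof, resp. estranged) edge is universally sub-coverticial (resp. aloof, resp.
estranged) — c1/c3/c4 by abc-iut-L4-t17's lifts (`Hom.IsFiniteEtaleCoveringGlobal.isElevated` /
`isAloof` / `isEstranged`), c2 by `coveringHomCan_isUniversallySubCoverticial`.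
[cite: MochizukiSemiAnbd2006, Rem. 2.4.1 p.26] -/
theorem BObj.remark_2_4_1_coveringHomCan (A : 𝒢.BObj) :
    (∀ v', 𝒢.IsElevated (A.coveringHomCan.base.vertexMap v') → A.coveringGraph.IsElevated v') ∧
    (∀ e', 𝒢.IsUniversallySubCoverticial (A.coveringHomCan.base.edgeMap e') →
      A.coveringGraph.IsUniversallySubCoverticial e') ∧
    (∀ e', 𝒢.IsAloof (A.coveringHomCan.base.edgeMap e') → A.coveringGraph.IsAloof e') ∧
    ∀ e', 𝒢.IsEstranged (A.coveringHomCan.base.edgeMap e') → A.coveringGraph.IsEstranged e' :=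
  ⟨fun v' hv => A.coveringHomCan_isFiniteEtaleCoveringGlobal.isElevated v' hv,
    fun e' he => A.coveringHomCan_isUniversallySubCoverticial e' he,
    fun e' he => A.coveringHomCan_isFiniteEtaleCoveringGlobal.isAloof e' he,
    fun e' he => A.coveringHomCan_isFiniteEtaleCoveringGlobal.isEstranged e' he⟩

/-! ### The abstract fact from covering rigidity (J1) -/

/-- **Composites of print's finite étale coverings are print's finite étale coverings, given covering
rigidity (J1) for the base factor** — (J1): every `φ : 𝒢′ → 𝒢` which is locally and globally the
covering attached to `A`, branch- and vertex-aligned, admits aligned local data over `A` whose lift is an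
equivalence with `φ^* ≅ (A × −) ⋙ lift` (the comparison of an abstract four-clause covering with print's
construction `𝒢_A`; hypothesis binder, not asserted). [cite: MochizukiSemiAnbd2006, Rem. 2.4.2 p.26] -/
theorem Hom.isFiniteEtaleCoveringGlobal_comp_of_rigidity
    (hJ1 : ∀ {𝒢 𝒢' : SemiGraphOfAnabelioids.{v₁, u₁, u}} (φ : Hom 𝒢' 𝒢) (A : 𝒢.BObj),
      φ.IsFiniteEtaleCoveringOf A → φ.IsGlobalCoveringOf A → φ.IsBranchAligned → φ.IsVertexAligned →
      ∃ (_ : HasBinaryProducts 𝒢.BObj) (𝔇 : φ.AlignedLocalData A),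
        𝔇.lift.IsEquivalence ∧ Nonempty (φ.pullbackFunctor ≅ Over.star A ⋙ 𝔇.lift))
    {ψ : Hom 𝒢'' 𝒢'} {φ : Hom 𝒢' 𝒢}
    (hψ : ψ.IsFiniteEtaleCoveringGlobal) (hφ : φ.IsFiniteEtaleCoveringGlobal) :
    (ψ.comp φ).IsFiniteEtaleCoveringGlobal := by
  obtain ⟨A, hφl, hφg, hφb, hφv⟩ := hφ
  obtain ⟨inst, 𝔇, h𝔇, ⟨e⟩⟩ := hJ1 φ A hφl hφg hφb hφv
  letI := inst
  haveI := h𝔇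
  exact Hom.isFiniteEtaleCoveringGlobal_comp_of_alignedLocalData 𝔇 e hφl.isProper hφb hφv hψ

/-- **[SemiAnbd] Remark 2.4.1 along finite étale coverings — the named fact F-1478
`remark_2_4_1_covering` for the cell's ABSTRACT four-clause coverings — from covering rigidity (J1)**
(hypothesis binder VERBATIM as in `Hom.isFiniteEtaleCoveringGlobal_comp_of_rigidity`; c1/c3/c4 are
unconditional, c2 = «print's coverings compose» via
`remark_2_4_1_covering_of_comp_isFiniteEtaleCoveringGlobal`).  CONDITIONAL result: F-1478 ⟸ (J1).
[cite: MochizukiSemiAnbd2006, Rem. 2.4.1 p.26] -/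
theorem remark_2_4_1_covering_of_rigidity
    (hJ1 : ∀ {𝒢 𝒢' : SemiGraphOfAnabelioids.{v₁, u₁, u}} (φ : Hom 𝒢' 𝒢) (A : 𝒢.BObj),
      φ.IsFiniteEtaleCoveringOf A → φ.IsGlobalCoveringOf A → φ.IsBranchAligned → φ.IsVertexAligned →
      ∃ (_ : HasBinaryProducts 𝒢.BObj) (𝔇 : φ.AlignedLocalData A),
        𝔇.lift.IsEquivalence ∧ Nonempty (φ.pullbackFunctor ≅ Over.star A ⋙ 𝔇.lift)) :
    Literature.AnabelianGeometry.SemiGraphs.SemiGraphOfAnabelioids.remark_2_4_1_covering.{v₁, u₁, u} :=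
  remark_2_4_1_covering_of_comp_isFiniteEtaleCoveringGlobal fun _ _ _ _ _ hψ hφ =>
    Hom.isFiniteEtaleCoveringGlobal_comp_of_rigidity hJ1 hψ hφ

end SemiGraphOfAnabelioids

end Literature.AnabelianGeometry.SemiGraphs
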